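import Literature.Probability.RandomPlanarGeometry.SAWBridgeZigzagEntropy
import Literature.Probability.RandomPlanarGeometry.SAWBridgeZigzagCase2
import Literature.Probability.RandomPlanarGeometry.SAWBridgeZigzagCaseThree
import Literature.Probability.RandomPlanarGeometry.SAWBridgeNoRenewal
import Literature.Probability.RandomPlanarGeometry.SAWBridgeNotBallisticOfRenewal
import Literature.Probability.RandomPlanarGeometry.SAWMaxHeightUnfolding
import Literature.Probability.RandomPlanarGeometry.SAWSubBallisticFromBridges
import Literature.Probability.RandomPlanarGeometry.SAWSubBallisticMeanSquare
import HarnessLib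

/-!
# Duminil-Copin–Hammond 2013, Theorem 1.1: the self-avoiding walk is sub-ballistic (every dimension `d ≥ 2`)

Topic `Literature/Probability/RandomPlanarGeometry` — the closing file of the lane «pcv-sawmu»'s programme
«DCH-1.1»: it assembles the tree's nodes into the named facts of `SAWSubBallistic.lean` /
`SAWHutchcroftTheorem12.lean` / `SAWSubexponentialBounds.lean`, all DISCHARGED here.

Source: H. Duminil-Copin, A. Hammond, *Self-avoiding walk is sub-ballistic*, Comm. Math. Phys. 324 (2013)
401–423, arXiv:1205.0401 [DuminilCopinHammond2013]. **Theorem 1.1** (arXiv v1, p. 1): "For each `v > 0`, there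
exists `ε > 0` such that, for each `n ∈ ℕ`, `P_{SAW_n}(max{‖γ_k‖ : 0 ≤ k ≤ n} ≥ vn) ≤ e^{-εn}`" (the tree's
`DuminilCopinHammond2013_thm1_1` is the eventual-`n` form, see that file's reading note). Printed proof (§2.4,
pp. 6–7): by contradiction with the *ballistic assumption*, refuted by Corollary 2.4 (⇐ Theorem 2.3 ⇐ Theorem 3.1
⇐ Proposition 3.2, §3) together with Theorem 2.5 (§4); then the axial symmetry and the max-height-monotone
unfolding pass from bridges to walks.

The chain in the tree (lane «pcv-sawmu», skeleton a-idea-2 `Sketch_v8_DCH11`; every node a theorem with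
standard axioms):
* K1 = **Proposition 3.2** `Zd.DCH_prop32_holds`: lit-1's assembly `Zd.dch_prop32_of_counts`
  (`SAWBridgeZigzagEntropy.lean`: Cases 1–3, the entropy arithmetic, Lemma 3.8) fed with the two counts on
  lit-2's zigzag layer (`SAWBridgeZigzag.lean`): a-p4's Case-2 count `Zd.card_sparseHighBridges_filter_card_zigzags_le`
  (`SAWBridgeZigzagCase2.lean`) and a-p3's Case-3 count `Zd.card_sparseHighBridges_filter_zigzags_mul_choose_le`
  (`SAWBridgeZigzagCaseThree.lean`), the zigzag statistic being the number of NON-DEGENERATE zigzags;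
* K2 = **Theorem 3.1** `Zd.DCH_thm31_holds` (`SAWBridgeSparseLevels.lean`: `thm31_of_prop32`);
* K3⁺ + K23 = **Theorem 2.3 / Corollary 2.4** in contrapositive form: a-p6's
  `Zd.bridgeNotBallisticAt_of_thm31_of_renewalDensity` (`SAWBridgeNotBallisticOfRenewal.lean`) fed with K2 and
  `Zd.renewalDensityExpSmall_of_thm25` (`SAWBridgeRenewalDensity.lean`) at the tree's **Theorem 2.5**
  `Zd.DuminilCopinHammond2013_thm2_5_holds` (`SAWBridgeNoRenewal.lean`) ⇒
  `Zd.DuminilCopinHammond2013_bridgeNotBallistic_holds` (the named fact of `SAWHutchcroftTheorem12.lean`);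
* K4 = **§2.4**: a-p4's `Zd.thm1_1_of_maxHeightUnfolding` with `Zd.maxHeightUnfolding`
  (`SAWSubBallisticFromBridges.lean`, `SAWMaxHeightUnfolding.lean`) ⇒ **`Zd.DuminilCopinHammond2013_thm1_1_holds`**;
* consumers made unconditional: `Zd.Hutchcroft2018_thm12_holds` (Hutchcroft 2018 Thm 1.2, via
  `Hutchcroft2018_thm12_of_thm1_1`) and `Zd.tendsto_meanSqEndpoint_div_sq` (DCH Corollary 1.2,
  `n^{-2}⟨‖γ_n‖²⟩ → 0`, via `DuminilCopinHammond2013_cor1_2`).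
-/

noncomputable section

open Finset Filter Topology Literature.Probability.LatticeModels Literature.Probability.Percolation
open scoped BigOperators

namespace Literature.Probability.RandomPlanarGeometry.SAW.Zd

/-- **Duminil-Copin–Hammond 2013, Proposition 3.2** (the tree's named `Prop` `DCH_prop32`), DISCHARGED: lit-1's
assembly over the counts of Cases 2 and 3 on the zigzag layer, with the non-degenerate zigzag count as the
statistic. [cite: DuminilCopinHammond2013, Proposition 3.2 (arXiv v1, p. 11; proof §3, pp. 13–17)] -/
theorem DCH_prop32_holds : DCH_prop32 := by
  refine dch_prop32_of_counts (fun {d} _ n γ => #((zigzags n γ).filter fun z => z.1 < z.2)) ?_ ?_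
  · intro d _ _ v _ k hk δ _ n m
    exact card_sparseHighBridges_filter_card_zigzags_le n v δ hk m
  · intro d _ _ v _ k _ δ _ n L t a r hL
    exact card_sparseHighBridges_filter_zigzags_mul_choose_le n v δ k L t a r hL

/-- **Duminil-Copin–Hammond 2013, Theorem 3.1** (the tree's named `Prop` `DCH_thm31`), DISCHARGED.
[cite: DuminilCopinHammond2013, Theorem 3.1 (arXiv v1, p. 11)] -/
theorem DCH_thm31_holds : DCH_thm31 := thm31_of_prop32 DCH_prop32_holds

/-- **Bridges are not ballistic** — the tree's named fact `DuminilCopinHammond2013_bridgeNotBallistic`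
(the negation of the ballistic assumption of §2.4, for every `d ≥ 2` and every `v > 0`), DISCHARGED: Theorem 3.1
and the exponential smallness of the renewal density (from Theorem 2.5) fed into Theorem 2.3/Corollary 2.4 in
contrapositive form. [cite: DuminilCopinHammond2013, Theorem 2.3, Corollary 2.4, Theorem 2.5 and §2.4 (arXiv v1, pp. 8, 10; proof of Corollary 2.4 p. 18)] -/
theorem DuminilCopinHammond2013_bridgeNotBallistic_holds : DuminilCopinHammond2013_bridgeNotBallistic := by
  intro d _ hd v hv
  exact bridgeNotBallisticAt_of_thm31_of_renewalDensity (DCH_thm31_holds d hd)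
    (fun δ hδ => renewalDensityExpSmall_of_thm25 DuminilCopinHammond2013_thm2_5_holds d hd hδ) v hv

/-- **Duminil-Copin–Hammond 2013, Theorem 1.1 — the self-avoiding walk is sub-ballistic**, in every dimension
`d ≥ 2`: the tree's named fact `DuminilCopinHammond2013_thm1_1`, DISCHARGED.
[cite: DuminilCopinHammond2013, Theorem 1.1 (arXiv v1, p. 1; proof §2.4, p. 10)] -/
theorem DuminilCopinHammond2013_thm1_1_holds : DuminilCopinHammond2013_thm1_1 :=
  thm1_1_of_maxHeightUnfolding maxHeightUnfolding DuminilCopinHammond2013_bridgeNotBallistic_holds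

/-- **Hutchcroft 2018, Theorem 1.2** — the tree's named fact `Hutchcroft2018_thm12`, now unconditional.
[cite: Hutchcroft2018HammersleyWelsh, Theorem 1.2; DuminilCopinHammond2013, Theorem 1.1] -/
theorem Hutchcroft2018_thm12_holds : Hutchcroft2018_thm12 :=
  Hutchcroft2018_thm12_of_thm1_1 DuminilCopinHammond2013_thm1_1_holds

/-- **Duminil-Copin–Hammond 2013, Corollary 1.2** — `lim_n n^{-2}⟨‖γ_n‖²⟩ = 0` under `P_{SAW_n}`, every `d ≥ 2`,
now unconditional. [cite: DuminilCopinHammond2013, Corollary 1.2 (§1.1)] -/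
theorem tendsto_meanSqEndpoint_div_sq {d : ℕ} [NeZero d] (hd : 2 ≤ d) :
    Tendsto (fun n : ℕ => meanSqEndpoint d n / (n : ℝ) ^ 2) atTop (𝓝 0) :=
  DuminilCopinHammond2013_cor1_2 DuminilCopinHammond2013_thm1_1_holds hd

end Literature.Probability.RandomPlanarGeometry.SAW.Zd

end
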